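import Mathlib.Analysis.Calculus.Deriv.MeanValue
import Mathlib.Analysis.Calculus.ContDiff.Basic
import Mathlib.Analysis.Calculus.FDeriv.Prod
import Mathlib.Analysis.Calculus.Deriv.Mul
import Mathlib.Analysis.Calculus.Deriv.Inv
import Mathlib.Analysis.Calculus.Deriv.Comp
import Mathlib.Analysis.Calculus.Deriv.Prod
import Literature.Analysis.FluidPDE.DissipativeMVEuler
import HarnessLib

/-!
# The ballistic free energy `H_Θ(ρ, ϑ) = ρ e(ρ, ϑ) - Θ ρ s(ρ, ϑ)` and its relative version

Thermodynamic potential behind the relative-energy method for the complete Euler /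
Navier–Stokes–Fourier systems (Feireisl–Novotný 2009, §2.2.3 and Ch. 3; Feireisl–Novotný 2012,
§3; Březina–Feireisl 2018, §3.1 eq. (3.3)). For an equation of state `eos : EulerEOS`
(`DissipativeMVEuler.lean`) satisfying Gibbs' relation (`IsGibbs`) and thermodynamic stability
(`IsThermodynamicallyStable`) we define

* `EulerEOS.helmholtz eos ρ ϑ = e - ϑ s` (specific Helmholtz free energy),
* `EulerEOS.ballisticFreeEnergy eos Θ ρ ϑ = ρ e(ρ,ϑ) - Θ ρ s(ρ,ϑ)` (`H_Θ(ρ,ϑ)`),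
* `EulerEOS.chemPotential eos ρ Θ = e - Θ s + p/ρ` at `(ρ, Θ)` (`= ∂_ρ H_Θ(ρ,Θ)`, the Gibbs
  function),
* `EulerEOS.relEnergyThermo eos r Θ ρ ϑ = H_Θ(ρ,ϑ) - ∂_ρH_Θ(r,Θ)(ρ - r) - H_Θ(r,Θ)` (the
  thermal part of BF's relative energy (3.3)),

and prove the structural facts used in every weak–strong uniqueness proof
([FN2009, Ch. 3, Prop. 3.2]; BF 2018 between (3.7) and (3.8)):
`∂_ρ H_Θ(ρ,Θ) = μ(ρ,Θ)`, `∂_ρ μ(ρ,Θ) = ∂_ρ p(ρ,Θ)/ρ > 0` (strict convexity of `ρ ↦ H_Θ(ρ,Θ)`),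
`∂_ϑ H_Θ(ρ,ϑ) = ρ ∂_ϑ s (ϑ - Θ)` with `∂_ϑ s = ∂_ϑ e/ϑ > 0` (so `ϑ ↦ H_Θ(ρ,ϑ)` is minimal at
`ϑ = Θ`), `r μ(r,Θ) - H_Θ(r,Θ) = p(r,Θ)`, and `relEnergyThermo ≥ 0`.
Quantitative (uniform) coercivity is in `BallisticFreeEnergyCoercivity.lean`.

A preliminary section gives the slice calculus of `C¹` functions of two real variables
(`g : ℝ → ℝ → ℝ` with `ContDiffOn ℝ n (uncurry g) U`, `U` open), relating the one-variable
`deriv`s in which `IsGibbs`/`IsThermodynamicallyStable` are stated to `fderiv (uncurry g)`.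

## References

* E. Feireisl, A. Novotný, *Singular limits in thermodynamics of viscous fluids*, Birkhäuser 2009,
  §2.2.3, Ch. 3 Prop. 3.2 (ballistic free energy, coercivity).
* E. Feireisl, A. Novotný, Arch. Ration. Mech. Anal. 204 (2012) 683–706, §3 (relative entropy).
* J. Březina, E. Feireisl, J. Math. Soc. Japan 70 (2018) 1227–1245, §3.1 (3.3), §3.2 (3.8).
-/

noncomputable section

open Set Filter Function
open scoped Topology

namespace Literature.Analysis.FluidPDE

namespace CompressibleEuler

/-! ## Slice calculus for `C¹` functions of two real variables -/

section TwoVar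

variable {g : ℝ → ℝ → ℝ} {U : Set (ℝ × ℝ)} {n : WithTop ℕ∞}

/-- A `Cⁿ` (`n ≥ 1`) function of two variables on an open set is Fréchet differentiable there.
[folklore] -/
theorem hasFDerivAt_uncurry (hg : ContDiffOn ℝ n (uncurry g) U) (hU : IsOpen U) (hn : 1 ≤ n)
    {z : ℝ × ℝ} (hz : z ∈ U) :
    HasFDerivAt (uncurry g) (fderiv ℝ (uncurry g) z) z :=
  ((hg.differentiableOn (by positivity)).differentiableAt (hU.mem_nhds hz)).hasFDerivAt

/-- Slice in the first variable: `d/dρ g(ρ, θ) = D(uncurry g)(ρ, θ)(1, 0)`. [folklore] -/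
theorem hasDerivAt_slice_fst (hg : ContDiffOn ℝ n (uncurry g) U) (hU : IsOpen U) (hn : 1 ≤ n)
    {r θ : ℝ} (h : (r, θ) ∈ U) :
    HasDerivAt (fun ρ => g ρ θ) (fderiv ℝ (uncurry g) (r, θ) (1, 0)) r := by
  have hc := (hasFDerivAt_uncurry hg hU hn h).comp r (hasFDerivAt_prodMk_left (𝕜 := ℝ) r θ)
  have hd := hc.hasDerivAt
  simpa [Function.comp_def] using hd

/-- Slice in the second variable: `d/dθ g(ρ, θ) = D(uncurry g)(ρ, θ)(0, 1)`. [folklore] -/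
theorem hasDerivAt_slice_snd (hg : ContDiffOn ℝ n (uncurry g) U) (hU : IsOpen U) (hn : 1 ≤ n)
    {r θ : ℝ} (h : (r, θ) ∈ U) :
    HasDerivAt (fun τ => g r τ) (fderiv ℝ (uncurry g) (r, θ) (0, 1)) θ := by
  have hc := (hasFDerivAt_uncurry hg hU hn h).comp θ (hasFDerivAt_prodMk_right (𝕜 := ℝ) r θ)
  have hd := hc.hasDerivAt
  simpa [Function.comp_def] using hd

/-- `deriv` of the first slice equals the partial Fréchet derivative. [folklore] -/
theorem deriv_slice_fst (hg : ContDiffOn ℝ n (uncurry g) U) (hU : IsOpen U) (hn : 1 ≤ n)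
    {r θ : ℝ} (h : (r, θ) ∈ U) :
    deriv (fun ρ => g ρ θ) r = fderiv ℝ (uncurry g) (r, θ) (1, 0) :=
  (hasDerivAt_slice_fst hg hU hn h).deriv

/-- `deriv` of the second slice equals the partial Fréchet derivative. [folklore] -/
theorem deriv_slice_snd (hg : ContDiffOn ℝ n (uncurry g) U) (hU : IsOpen U) (hn : 1 ≤ n)
    {r θ : ℝ} (h : (r, θ) ∈ U) :
    deriv (fun τ => g r τ) θ = fderiv ℝ (uncurry g) (r, θ) (0, 1) :=
  (hasDerivAt_slice_snd hg hU hn h).deriv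

/-- The Fréchet derivative in terms of the two partial derivatives:
`D(uncurry g)(r,θ)(a,b) = a ∂₁g + b ∂₂g`. [folklore] -/
theorem fderiv_uncurry_apply (hg : ContDiffOn ℝ n (uncurry g) U) (hU : IsOpen U) (hn : 1 ≤ n)
    {r θ : ℝ} (h : (r, θ) ∈ U) (a b : ℝ) :
    fderiv ℝ (uncurry g) (r, θ) (a, b) =
      a * deriv (fun ρ => g ρ θ) r + b * deriv (fun τ => g r τ) θ := by
  rw [deriv_slice_fst hg hU hn h, deriv_slice_snd hg hU hn h]
  have : ((a, b) : ℝ × ℝ) = a • (1, 0) + b • (0, 1) := by ext <;> simp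
  rw [this, map_add, map_smul, map_smul, smul_eq_mul, smul_eq_mul]

/-- The partial derivatives of a `Cⁿ` (`n ≥ 1`) function are continuous (first variable).
[folklore] -/
theorem continuousOn_deriv_slice_fst (hg : ContDiffOn ℝ n (uncurry g) U) (hU : IsOpen U)
    (hn : 1 ≤ n) : ContinuousOn (fun z : ℝ × ℝ => deriv (fun ρ => g ρ z.2) z.1) U := by
  have hc : ContinuousOn (fun z => fderiv ℝ (uncurry g) z (1, 0)) U :=
    (hg.continuousOn_fderiv_of_isOpen hU hn).clm_apply continuousOn_const
  refine hc.congr fun z hz => ?_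
  obtain ⟨r, θ⟩ := z
  exact deriv_slice_fst hg hU hn hz

/-- The partial derivatives of a `Cⁿ` (`n ≥ 1`) function are continuous (second variable).
[folklore] -/
theorem continuousOn_deriv_slice_snd (hg : ContDiffOn ℝ n (uncurry g) U) (hU : IsOpen U)
    (hn : 1 ≤ n) : ContinuousOn (fun z : ℝ × ℝ => deriv (fun τ => g z.1 τ) z.2) U := by
  have hc : ContinuousOn (fun z => fderiv ℝ (uncurry g) z (0, 1)) U :=
    (hg.continuousOn_fderiv_of_isOpen hU hn).clm_apply continuousOn_const
  refine hc.congr fun z hz => ?_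
  obtain ⟨r, θ⟩ := z
  exact deriv_slice_snd hg hU hn hz

/-- **Chain rule along a curve**: `d/dt g(a t, b t) = ∂₁g · a' + ∂₂g · b'` for `g ∈ Cⁿ`, `n ≥ 1`,
near `(a t, b t)`. [folklore] -/
theorem hasDerivAt_comp₂ (hg : ContDiffOn ℝ n (uncurry g) U) (hU : IsOpen U) (hn : 1 ≤ n)
    {a b : ℝ → ℝ} {a' b' t : ℝ} (h : (a t, b t) ∈ U) (ha : HasDerivAt a a' t)
    (hb : HasDerivAt b b' t) :
    HasDerivAt (fun τ => g (a τ) (b τ))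
      (deriv (fun ρ => g ρ (b t)) (a t) * a' + deriv (fun θ => g (a t) θ) (b t) * b') t := by
  have hc := (hasFDerivAt_uncurry hg hU hn h).comp_hasDerivAt t (ha.prodMk hb :)
  have heq : fderiv ℝ (uncurry g) (a t, b t) (a', b') =
      deriv (fun ρ => g ρ (b t)) (a t) * a' + deriv (fun θ => g (a t) θ) (b t) * b' := by
    rw [fderiv_uncurry_apply hg hU hn h]; ring
  rw [← heq]
  exact hc

end TwoVar

/-- The open quadrant `(0,∞)²` is open. [folklore] -/
theorem isOpen_quadrant : IsOpen (Ioi (0 : ℝ) ×ˢ Ioi (0 : ℝ)) := isOpen_Ioi.prod isOpen_Ioi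

namespace EulerEOS

variable (eos : EulerEOS)

/-! ## Thermodynamic potentials -/

/-- The specific Helmholtz free energy `f(ρ,ϑ) = e(ρ,ϑ) - ϑ s(ρ,ϑ)`.
[cite: FeireislNovotny2009, §2.2.3] -/
def helmholtz (ρ ϑ : ℝ) : ℝ := eos.e ρ ϑ - ϑ * eos.s ρ ϑ

/-- The **ballistic free energy** `H_Θ(ρ,ϑ) = ρ e(ρ,ϑ) - Θ ρ s(ρ,ϑ)` relative to the reference
temperature `Θ`. [cite: BrezinaFeireisl2018, §3.1] -/
def ballisticFreeEnergy (Θ ρ ϑ : ℝ) : ℝ := ρ * eos.e ρ ϑ - Θ * (ρ * eos.s ρ ϑ)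

/-- The Gibbs function / chemical potential `μ(ρ,Θ) = e - Θ s + p/ρ` at `(ρ,Θ)`; under Gibbs'
relation it is `∂_ρ H_Θ(ρ,Θ)` (`hasDerivAt_ballisticFreeEnergy_rho`).
[cite: BrezinaFeireisl2018, §3.1 (∂H_Θ/∂ϱ)] -/
def chemPotential (ρ Θ : ℝ) : ℝ := eos.e ρ Θ - Θ * eos.s ρ Θ + eos.p ρ Θ / ρ

/-- The thermal part of the relative energy of Březina–Feireisl (3.3):
`H_Θ(ρ,ϑ) - ∂_ρH_Θ(r,Θ)(ρ - r) - H_Θ(r,Θ)`. [cite: BrezinaFeireisl2018, (3.3)] -/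
def relEnergyThermo (r Θ ρ ϑ : ℝ) : ℝ :=
  eos.ballisticFreeEnergy Θ ρ ϑ - eos.chemPotential r Θ * (ρ - r) - eos.ballisticFreeEnergy Θ r Θ

/-- On the diagonal `ϑ = Θ`, `H_Θ(ρ,Θ) = ρ f(ρ,Θ)`. [folklore] -/
theorem ballisticFreeEnergy_self (Θ ρ : ℝ) :
    eos.ballisticFreeEnergy Θ ρ Θ = ρ * eos.helmholtz ρ Θ := by
  simp only [ballisticFreeEnergy, helmholtz]; ring

/-- `r μ(r,Θ) - H_Θ(r,Θ) = p(r,Θ)` (no hypothesis beyond `r ≠ 0`).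
[cite: BrezinaFeireisl2018, §3.1.1] -/
theorem chemPotential_mul_sub_ballisticFreeEnergy {r : ℝ} (hr : r ≠ 0) (Θ : ℝ) :
    eos.chemPotential r Θ * r - eos.ballisticFreeEnergy Θ r Θ = eos.p r Θ := by
  simp only [chemPotential, ballisticFreeEnergy]
  field_simp
  ring

/-- The relative thermal energy vanishes on the diagonal. [folklore] -/
@[simp] theorem relEnergyThermo_self (r Θ : ℝ) : eos.relEnergyThermo r Θ r Θ = 0 := by
  simp [relEnergyThermo]

/-- Splitting of the relative thermal energy into its `ϑ`-part and its `ρ`-part: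
`R(ρ,ϑ) = [H_Θ(ρ,ϑ) - H_Θ(ρ,Θ)] + R(ρ,Θ)`. [folklore] -/
theorem relEnergyThermo_split (r Θ ρ ϑ : ℝ) :
    eos.relEnergyThermo r Θ ρ ϑ =
      (eos.ballisticFreeEnergy Θ ρ ϑ - eos.ballisticFreeEnergy Θ ρ Θ) +
        eos.relEnergyThermo r Θ ρ Θ := by
  simp only [relEnergyThermo]; ring

/-! ## Slice regularity of the constitutive functions under Gibbs' relation -/

section Gibbs

variable {eos}

/-- `ρ ↦ e(ρ,ϑ)` is differentiable on `ρ > 0` (`ϑ > 0`). [folklore] -/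
theorem IsGibbs.hasDerivAt_e_rho (hG : eos.IsGibbs) {ρ ϑ : ℝ} (hρ : 0 < ρ) (hϑ : 0 < ϑ) :
    HasDerivAt (fun r => eos.e r ϑ) (deriv (fun r => eos.e r ϑ) ρ) ρ := by
  rw [deriv_slice_fst hG.2.1 isOpen_quadrant le_rfl ⟨hρ, hϑ⟩]
  exact hasDerivAt_slice_fst hG.2.1 isOpen_quadrant le_rfl ⟨hρ, hϑ⟩

/-- `ϑ ↦ e(ρ,ϑ)` is differentiable on `ϑ > 0` (`ρ > 0`). [folklore] -/
theorem IsGibbs.hasDerivAt_e_theta (hG : eos.IsGibbs) {ρ ϑ : ℝ} (hρ : 0 < ρ) (hϑ : 0 < ϑ) :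
    HasDerivAt (fun θ => eos.e ρ θ) (deriv (fun θ => eos.e ρ θ) ϑ) ϑ := by
  rw [deriv_slice_snd hG.2.1 isOpen_quadrant le_rfl ⟨hρ, hϑ⟩]
  exact hasDerivAt_slice_snd hG.2.1 isOpen_quadrant le_rfl ⟨hρ, hϑ⟩

/-- `ρ ↦ s(ρ,ϑ)` is differentiable on `ρ > 0`. [folklore] -/
theorem IsGibbs.hasDerivAt_s_rho (hG : eos.IsGibbs) {ρ ϑ : ℝ} (hρ : 0 < ρ) (hϑ : 0 < ϑ) :
    HasDerivAt (fun r => eos.s r ϑ) (deriv (fun r => eos.s r ϑ) ρ) ρ := by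
  rw [deriv_slice_fst hG.2.2.1 isOpen_quadrant le_rfl ⟨hρ, hϑ⟩]
  exact hasDerivAt_slice_fst hG.2.2.1 isOpen_quadrant le_rfl ⟨hρ, hϑ⟩

/-- `ϑ ↦ s(ρ,ϑ)` is differentiable on `ϑ > 0`. [folklore] -/
theorem IsGibbs.hasDerivAt_s_theta (hG : eos.IsGibbs) {ρ ϑ : ℝ} (hρ : 0 < ρ) (hϑ : 0 < ϑ) :
    HasDerivAt (fun θ => eos.s ρ θ) (deriv (fun θ => eos.s ρ θ) ϑ) ϑ := by
  rw [deriv_slice_snd hG.2.2.1 isOpen_quadrant le_rfl ⟨hρ, hϑ⟩]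
  exact hasDerivAt_slice_snd hG.2.2.1 isOpen_quadrant le_rfl ⟨hρ, hϑ⟩

/-- `ρ ↦ p(ρ,ϑ)` is differentiable on `ρ > 0`. [folklore] -/
theorem IsGibbs.hasDerivAt_p_rho (hG : eos.IsGibbs) {ρ ϑ : ℝ} (hρ : 0 < ρ) (hϑ : 0 < ϑ) :
    HasDerivAt (fun r => eos.p r ϑ) (deriv (fun r => eos.p r ϑ) ρ) ρ := by
  rw [deriv_slice_fst hG.1 isOpen_quadrant le_rfl ⟨hρ, hϑ⟩]
  exact hasDerivAt_slice_fst hG.1 isOpen_quadrant le_rfl ⟨hρ, hϑ⟩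

/-- `ϑ ↦ p(ρ,ϑ)` is differentiable on `ϑ > 0`. [folklore] -/
theorem IsGibbs.hasDerivAt_p_theta (hG : eos.IsGibbs) {ρ ϑ : ℝ} (hρ : 0 < ρ) (hϑ : 0 < ϑ) :
    HasDerivAt (fun θ => eos.p ρ θ) (deriv (fun θ => eos.p ρ θ) ϑ) ϑ := by
  rw [deriv_slice_snd hG.1 isOpen_quadrant le_rfl ⟨hρ, hϑ⟩]
  exact hasDerivAt_slice_snd hG.1 isOpen_quadrant le_rfl ⟨hρ, hϑ⟩

/-- Gibbs' relation, `ϑ`-component: `ϑ ∂_ϑ s = ∂_ϑ e`. [cite: BrezinaFeireisl2018, (1.5)] -/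
theorem IsGibbs.theta_mul_deriv_s_theta (hG : eos.IsGibbs) {ρ ϑ : ℝ} (hρ : 0 < ρ) (hϑ : 0 < ϑ) :
    ϑ * deriv (fun θ => eos.s ρ θ) ϑ = deriv (fun θ => eos.e ρ θ) ϑ :=
  (hG.2.2.2 ρ ϑ hρ hϑ).1

/-- Gibbs' relation, `ρ`-component: `ϑ ∂_ρ s = ∂_ρ e - p/ρ²`. [cite: BrezinaFeireisl2018, (1.5)] -/
theorem IsGibbs.theta_mul_deriv_s_rho (hG : eos.IsGibbs) {ρ ϑ : ℝ} (hρ : 0 < ρ) (hϑ : 0 < ϑ) :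
    ϑ * deriv (fun r => eos.s r ϑ) ρ = deriv (fun r => eos.e r ϑ) ρ - eos.p ρ ϑ / ρ ^ 2 :=
  (hG.2.2.2 ρ ϑ hρ hϑ).2

/-! ## First derivatives of the ballistic free energy -/

/-- **`∂_ρ H_Θ(ρ,Θ) = μ(ρ,Θ)`** for `ρ, Θ > 0` (Gibbs' relation in `ρ`).
[cite: BrezinaFeireisl2018, Remark 3.1] -/
theorem IsGibbs.hasDerivAt_ballisticFreeEnergy_rho (hG : eos.IsGibbs) {ρ Θ : ℝ} (hρ : 0 < ρ) (hΘ : 0 < Θ) :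
    HasDerivAt (fun r => eos.ballisticFreeEnergy Θ r Θ) (eos.chemPotential ρ Θ) ρ := by
  have he := hG.hasDerivAt_e_rho hρ hΘ
  have hs := hG.hasDerivAt_s_rho hρ hΘ
  have hgibbs := hG.theta_mul_deriv_s_rho hρ hΘ
  have hρ' : ρ ≠ 0 := hρ.ne'
  have hp : eos.p ρ Θ = ρ ^ 2 *
      (deriv (fun r => eos.e r Θ) ρ - Θ * deriv (fun r => eos.s r Θ) ρ) := by
    have h1 : eos.p ρ Θ / ρ ^ 2 =
        deriv (fun r => eos.e r Θ) ρ - Θ * deriv (fun r => eos.s r Θ) ρ := by linarith [hgibbs]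
    rw [← h1]; field_simp
  have h : HasDerivAt (fun r => r * eos.e r Θ - Θ * (r * eos.s r Θ))
      (1 * eos.e ρ Θ + ρ * deriv (fun r => eos.e r Θ) ρ -
        Θ * (1 * eos.s ρ Θ + ρ * deriv (fun r => eos.s r Θ) ρ)) ρ :=
    ((hasDerivAt_id' ρ).fun_mul he).fun_sub (((hasDerivAt_id' ρ).fun_mul hs).const_mul Θ)
  unfold ballisticFreeEnergy
  refine h.congr_deriv ?_
  unfold chemPotential
  rw [hp]
  field_simp
  ring

/-- **`∂_ρ μ(ρ,Θ) = ∂_ρ p(ρ,Θ) / ρ`** for `ρ, Θ > 0` (Gibbs' relation in `ρ`); with thermodynamic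
stability this is `> 0`, i.e. `ρ ↦ H_Θ(ρ,Θ)` is strictly convex.
[cite: FeireislNovotny2009, Ch. 3 Prop. 3.2] -/
theorem IsGibbs.hasDerivAt_chemPotential_rho (hG : eos.IsGibbs) {ρ Θ : ℝ} (hρ : 0 < ρ) (hΘ : 0 < Θ) :
    HasDerivAt (fun r => eos.chemPotential r Θ) (deriv (fun r => eos.p r Θ) ρ / ρ) ρ := by
  have he := hG.hasDerivAt_e_rho hρ hΘ
  have hs := hG.hasDerivAt_s_rho hρ hΘ
  have hp := hG.hasDerivAt_p_rho hρ hΘ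
  have hgibbs := hG.theta_mul_deriv_s_rho hρ hΘ
  have hρ' : ρ ≠ 0 := hρ.ne'
  have h : HasDerivAt (fun r => eos.e r Θ - Θ * eos.s r Θ + eos.p r Θ / r)
      (deriv (fun r => eos.e r Θ) ρ - Θ * deriv (fun r => eos.s r Θ) ρ +
        (deriv (fun r => eos.p r Θ) ρ * ρ - eos.p ρ Θ * 1) / ρ ^ 2) ρ :=
    (he.fun_sub (hs.const_mul Θ)).fun_add (hp.fun_div (hasDerivAt_id' ρ) hρ')
  unfold chemPotential
  refine h.congr_deriv ?_
  have h1 : deriv (fun r => eos.e r Θ) ρ - Θ * deriv (fun r => eos.s r Θ) ρ =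
      eos.p ρ Θ / ρ ^ 2 := by linarith [hgibbs]
  rw [h1]
  field_simp
  ring

/-- **`∂_ϑ H_Θ(ρ,ϑ) = ρ ∂_ϑ s(ρ,ϑ) (ϑ - Θ)`** for `ρ, ϑ > 0` (Gibbs' relation in `ϑ`).
[cite: FeireislNovotny2009, Ch. 3 Prop. 3.2] -/
theorem IsGibbs.hasDerivAt_ballisticFreeEnergy_theta (hG : eos.IsGibbs) {ρ ϑ : ℝ} (Θ : ℝ) (hρ : 0 < ρ)
    (hϑ : 0 < ϑ) :
    HasDerivAt (fun θ => eos.ballisticFreeEnergy Θ ρ θ)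
      (ρ * deriv (fun θ => eos.s ρ θ) ϑ * (ϑ - Θ)) ϑ := by
  have he := hG.hasDerivAt_e_theta hρ hϑ
  have hs := hG.hasDerivAt_s_theta hρ hϑ
  have hgibbs := hG.theta_mul_deriv_s_theta hρ hϑ
  have h : HasDerivAt (fun θ => ρ * eos.e ρ θ - Θ * (ρ * eos.s ρ θ))
      (ρ * deriv (fun θ => eos.e ρ θ) ϑ - Θ * (ρ * deriv (fun θ => eos.s ρ θ) ϑ)) ϑ :=
    (he.const_mul ρ).fun_sub ((hs.const_mul ρ).const_mul Θ)
  unfold ballisticFreeEnergy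
  refine h.congr_deriv ?_
  rw [← hgibbs]
  ring

/-- `d/dϑ (f(ρ,ϑ)/ϑ) = -e(ρ,ϑ)/ϑ²` (Gibbs' relation in `ϑ`): the free energy over temperature
decreases at rate `e/ϑ²`. [folklore] -/
theorem IsGibbs.hasDerivAt_helmholtz_div_theta (hG : eos.IsGibbs) {ρ ϑ : ℝ} (hρ : 0 < ρ) (hϑ : 0 < ϑ) :
    HasDerivAt (fun θ => eos.helmholtz ρ θ / θ) (-(eos.e ρ ϑ) / ϑ ^ 2) ϑ := by
  have he := hG.hasDerivAt_e_theta hρ hϑ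
  have hs := hG.hasDerivAt_s_theta hρ hϑ
  have hgibbs := hG.theta_mul_deriv_s_theta hρ hϑ
  have hϑ' : ϑ ≠ 0 := hϑ.ne'
  have hf : HasDerivAt (fun θ => eos.e ρ θ - θ * eos.s ρ θ)
      (deriv (fun θ => eos.e ρ θ) ϑ - (1 * eos.s ρ ϑ + ϑ * deriv (fun θ => eos.s ρ θ) ϑ)) ϑ :=
    he.fun_sub ((hasDerivAt_id' ϑ).fun_mul hs)
  have h := hf.fun_div (hasDerivAt_id' ϑ) hϑ'
  unfold helmholtz
  refine h.congr_deriv ?_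
  rw [← hgibbs]
  field_simp
  ring

end Gibbs

/-! ## Signs under thermodynamic stability -/

section Stability

variable {eos}

/-- `∂_ϑ s = ∂_ϑ e / ϑ > 0` for `ρ, ϑ > 0`. [cite: BrezinaFeireisl2018, (1.5), (2.19)] -/
theorem deriv_s_theta_pos (hG : eos.IsGibbs) (hS : eos.IsThermodynamicallyStable) {ρ ϑ : ℝ} (hρ : 0 < ρ) (hϑ : 0 < ϑ) :
    0 < deriv (fun θ => eos.s ρ θ) ϑ := by
  have h := hG.theta_mul_deriv_s_theta hρ hϑ
  have hpos := (hS ρ ϑ hρ hϑ).2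
  rw [← h] at hpos
  exact pos_of_mul_pos_right hpos hϑ.le

/-- `∂_ρ μ(ρ,Θ) > 0`: the chemical potential is strictly increasing in `ρ`.
[cite: FeireislNovotny2009, Ch. 3 Prop. 3.2] -/
theorem deriv_chemPotential_rho_pos (hS : eos.IsThermodynamicallyStable) {ρ Θ : ℝ} (hρ : 0 < ρ) (hΘ : 0 < Θ) :
    0 < deriv (fun r => eos.p r Θ) ρ / ρ :=
  div_pos (hS ρ Θ hρ hΘ).1 hρ

/-- `ρ ↦ μ(ρ,Θ)` is strictly monotone on `(0,∞)`. [cite: FeireislNovotny2009, Ch. 3 Prop. 3.2] -/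
theorem strictMonoOn_chemPotential (hG : eos.IsGibbs) (hS : eos.IsThermodynamicallyStable) {Θ : ℝ} (hΘ : 0 < Θ) :
    StrictMonoOn (fun r => eos.chemPotential r Θ) (Ioi 0) := by
  refine strictMonoOn_of_deriv_pos (convex_Ioi 0) (fun r hr => ?_) (fun r hr => ?_)
  · exact (hG.hasDerivAt_chemPotential_rho hr hΘ).continuousAt.continuousWithinAt
  · rw [interior_Ioi] at hr
    rw [(hG.hasDerivAt_chemPotential_rho hr hΘ).deriv]
    exact deriv_chemPotential_rho_pos hS hr hΘ

/-- **Monotonicity of `ϑ ↦ H_Θ(ρ,ϑ)` above `Θ`.** [cite: FeireislNovotny2009, Ch. 3 Prop. 3.2] -/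
theorem monotoneOn_ballisticFreeEnergy_theta (hG : eos.IsGibbs) (hS : eos.IsThermodynamicallyStable) {ρ Θ : ℝ} (hρ : 0 < ρ) (hΘ : 0 < Θ) :
    MonotoneOn (fun θ => eos.ballisticFreeEnergy Θ ρ θ) (Ici Θ) := by
  refine monotoneOn_of_deriv_nonneg (convex_Ici Θ) (fun θ hθ => ?_) (fun θ hθ => ?_)
    (fun θ hθ => ?_)
  · exact (hG.hasDerivAt_ballisticFreeEnergy_theta Θ hρ (hΘ.trans_le hθ)).continuousAt
      |>.continuousWithinAt
  · rw [interior_Ici] at hθ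
    exact (hG.hasDerivAt_ballisticFreeEnergy_theta Θ hρ (hΘ.trans hθ)).differentiableAt
      |>.differentiableWithinAt
  · rw [interior_Ici] at hθ
    rw [(hG.hasDerivAt_ballisticFreeEnergy_theta Θ hρ (hΘ.trans hθ)).deriv]
    have := deriv_s_theta_pos hG hS hρ (hΘ.trans hθ)
    have hθ' : 0 ≤ θ - Θ := sub_nonneg.2 (le_of_lt hθ)
    positivity

/-- **Antitonicity of `ϑ ↦ H_Θ(ρ,ϑ)` below `Θ`.** [cite: FeireislNovotny2009, Ch. 3 Prop. 3.2] -/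
theorem antitoneOn_ballisticFreeEnergy_theta (hG : eos.IsGibbs) (hS : eos.IsThermodynamicallyStable) {ρ Θ : ℝ} (hρ : 0 < ρ) :
    AntitoneOn (fun θ => eos.ballisticFreeEnergy Θ ρ θ) (Ioc 0 Θ) := by
  refine antitoneOn_of_deriv_nonpos (convex_Ioc 0 Θ) (fun θ hθ => ?_) (fun θ hθ => ?_)
    (fun θ hθ => ?_)
  · exact (hG.hasDerivAt_ballisticFreeEnergy_theta Θ hρ hθ.1).continuousAt.continuousWithinAt
  · rw [interior_Ioc] at hθ
    exact (hG.hasDerivAt_ballisticFreeEnergy_theta Θ hρ hθ.1).differentiableAt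
      |>.differentiableWithinAt
  · rw [interior_Ioc] at hθ
    rw [(hG.hasDerivAt_ballisticFreeEnergy_theta Θ hρ hθ.1).deriv]
    have := deriv_s_theta_pos hG hS hρ hθ.1
    have hθ' : θ - Θ ≤ 0 := sub_nonpos.2 (le_of_lt hθ.2)
    exact mul_nonpos_of_nonneg_of_nonpos (by positivity) hθ'

/-- **`H_Θ(ρ,·)` is minimal at `ϑ = Θ`**: `H_Θ(ρ,Θ) ≤ H_Θ(ρ,ϑ)` for all `ρ, ϑ, Θ > 0`.
[cite: FeireislNovotny2009, Ch. 3 Prop. 3.2] -/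
theorem ballisticFreeEnergy_self_le (hG : eos.IsGibbs) (hS : eos.IsThermodynamicallyStable) {ρ ϑ Θ : ℝ} (hρ : 0 < ρ) (hϑ : 0 < ϑ) (hΘ : 0 < Θ) :
    eos.ballisticFreeEnergy Θ ρ Θ ≤ eos.ballisticFreeEnergy Θ ρ ϑ := by
  rcases le_total Θ ϑ with h | h
  · exact monotoneOn_ballisticFreeEnergy_theta hG hS hρ hΘ (le_refl Θ) h h
  · exact antitoneOn_ballisticFreeEnergy_theta hG hS hρ ⟨hϑ, h⟩ ⟨hΘ, le_refl Θ⟩ h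

/-- **Convexity part**: `R(ρ,Θ) = H_Θ(ρ,Θ) - μ(r,Θ)(ρ-r) - H_Θ(r,Θ) ≥ 0` for `ρ, r, Θ > 0`
(the strictly convex function `ρ ↦ H_Θ(ρ,Θ)` lies above its tangent at `r`).
[cite: FeireislNovotny2009, Ch. 3 Prop. 3.2] -/
theorem relEnergyThermo_diag_nonneg (hG : eos.IsGibbs) (hS : eos.IsThermodynamicallyStable) {r Θ ρ : ℝ} (hr : 0 < r) (hΘ : 0 < Θ) (hρ : 0 < ρ) :
    0 ≤ eos.relEnergyThermo r Θ ρ Θ := by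
  -- `g(σ) := H_Θ(σ,Θ) - μ(r,Θ) σ` has derivative `μ(σ,Θ) - μ(r,Θ)`, `≤ 0` left of `r`, `≥ 0` right
  set g : ℝ → ℝ := fun σ => eos.ballisticFreeEnergy Θ σ Θ - eos.chemPotential r Θ * σ with hg
  have hderiv : ∀ σ, 0 < σ → HasDerivAt g (eos.chemPotential σ Θ - eos.chemPotential r Θ) σ := by
    intro σ hσ
    have := (hG.hasDerivAt_ballisticFreeEnergy_rho hσ hΘ).fun_sub
      ((hasDerivAt_id' σ).const_mul (eos.chemPotential r Θ))
    simpa [hg] using this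
  have hmono := strictMonoOn_chemPotential hG hS hΘ
  have key : g r ≤ g ρ := by
    rcases le_total r ρ with h | h
    · -- monotone on `[r, ∞)`
      have hm : MonotoneOn g (Ici r) := by
        refine monotoneOn_of_deriv_nonneg (convex_Ici r) (fun σ hσ => ?_) (fun σ hσ => ?_)
          (fun σ hσ => ?_)
        · exact (hderiv σ (hr.trans_le hσ)).continuousAt.continuousWithinAt
        · rw [interior_Ici] at hσ
          exact (hderiv σ (hr.trans hσ)).differentiableAt.differentiableWithinAt
        · rw [interior_Ici] at hσ
          rw [(hderiv σ (hr.trans hσ)).deriv, sub_nonneg]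
          exact (hmono.le_iff_le hr (hr.trans hσ)).2 (le_of_lt hσ)
      exact hm (le_refl r) h h
    · -- antitone on `(0, r]`
      have hm : AntitoneOn g (Ioc 0 r) := by
        refine antitoneOn_of_deriv_nonpos (convex_Ioc 0 r) (fun σ hσ => ?_) (fun σ hσ => ?_)
          (fun σ hσ => ?_)
        · exact (hderiv σ hσ.1).continuousAt.continuousWithinAt
        · rw [interior_Ioc] at hσ
          exact (hderiv σ hσ.1).differentiableAt.differentiableWithinAt
        · rw [interior_Ioc] at hσ
          rw [(hderiv σ hσ.1).deriv, sub_nonpos]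
          exact (hmono.le_iff_le hσ.1 hr).2 (le_of_lt hσ.2)
      exact hm ⟨hρ, h⟩ ⟨hr, le_refl r⟩ h
  have : eos.relEnergyThermo r Θ ρ Θ = g ρ - g r := by
    simp only [relEnergyThermo, hg]; ring
  rw [this]; linarith

/-- `R(ρ,Θ) ≤ R(ρ,ϑ)`: the relative thermal energy is smallest on the reference isotherm.
[cite: FeireislNovotny2009, Ch. 3 Prop. 3.2] -/
theorem relEnergyThermo_diag_le (hG : eos.IsGibbs) (hS : eos.IsThermodynamicallyStable) {r Θ ρ ϑ : ℝ} (hΘ : 0 < Θ) (hρ : 0 < ρ) (hϑ : 0 < ϑ) :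
    eos.relEnergyThermo r Θ ρ Θ ≤ eos.relEnergyThermo r Θ ρ ϑ := by
  rw [eos.relEnergyThermo_split r Θ ρ ϑ]
  have := ballisticFreeEnergy_self_le hG hS (Θ := Θ) hρ hϑ hΘ
  linarith

/-- **Non-negativity of the relative thermal energy**: `R(ρ,ϑ | r,Θ) ≥ 0` for
`ρ, ϑ, r, Θ > 0`. [cite: BrezinaFeireisl2018, (3.8)] -/
theorem relEnergyThermo_nonneg (hG : eos.IsGibbs) (hS : eos.IsThermodynamicallyStable) {r Θ ρ ϑ : ℝ} (hr : 0 < r) (hΘ : 0 < Θ) (hρ : 0 < ρ)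
    (hϑ : 0 < ϑ) : 0 ≤ eos.relEnergyThermo r Θ ρ ϑ :=
  (relEnergyThermo_diag_nonneg hG hS hr hΘ hρ).trans (relEnergyThermo_diag_le hG hS hΘ hρ hϑ)

end Stability

end EulerEOS

end CompressibleEuler

end Literature.Analysis.FluidPDE
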